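import Literature.Analysis.FluidPDE.CompressibleEulerImplosionNearAnalytic
import Literature.Analysis.FluidPDE.CompressibleEulerImplosionNearPiece4
import HarnessLib

/-!
# Near-`P_s` graph barriers of contact order 4: on which side the analytic branch lies

The order-4 version of `CompressibleEulerImplosionNearAnalytic` (used on the LEFT of `P_s`, where the
paper's near-left barrier matches the branch to order `n = 3`): if `β` is a `C¹` barrier with
`G(W₀ + x, β(x), β′(x)) = x⁴ Q(x)` then, along the analytic branch, `φ = Z − β(W − W₀)` is either
`≡ 0` (impossible for `Q(0) ≠ 0`) or `sⁿ g` with `g(0) ≠ 0`; the order comparison forces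
`n = k ∉ ℕ` unless `n = 4`, and then `sign g(0) = sign Q(0)` because `4 − k > 0` (`r < r₄`). Hence
`sign φ = sign Q(0)` on a punctured neighbourhood of `s = 0` (both sides, `s⁴ > 0`).

[cite: BuckmasterCaolaboraGomezserrano2025, Lemma 3.4, Prop. 3.3, Prop. 3.5]
-/

noncomputable section

open Set Filter Topology

namespace Literature.Analysis.FluidPDE

namespace BuckmasterCaolaboraGomezserrano2025

namespace Monatomic

namespace NearPiece

/-- [folklore] -/
theorem analyticAt_beta4 (Z0 B1 B2 B3 b4 y : ℝ) : AnalyticAt ℝ (beta4 Z0 B1 B2 B3 b4) y := by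
  have hid : AnalyticAt ℝ (fun x : ℝ => x) y := analyticAt_id
  have hm : ∀ (c : ℝ) (n : ℕ), AnalyticAt ℝ (fun x : ℝ => c * x ^ n) y := fun c n =>
    analyticAt_const.mul (hid.pow n)
  have h : AnalyticAt ℝ (fun x : ℝ => Z0 + B1 * x + B2 * x ^ 2 + B3 * x ^ 3 + b4 * x ^ 4) y :=
    (((analyticAt_const.add (analyticAt_const.mul hid)).add (hm B2 2)).add (hm B3 3)).add (hm b4 4)
  exact h

/-- [folklore] -/
theorem analyticAt_beta4Near (r Z0 B1 b4 y : ℝ) : AnalyticAt ℝ (beta4Near r Z0 B1 b4) y :=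
  analyticAt_beta4 _ _ _ _ _ y

end NearPiece

open NearPiece

attribute [local irreducible] Gam

/-- Algebra of the order comparison, case `n = 4 + j ≥ 5`: divide the key identity by `s^4`.
[folklore] -/
theorem order_identity_ge4 {s A B gs gps X Qx Γs : ℝ} {j : ℕ} (hs : s ≠ 0)
    (h : A * B * (((3 + j + 1 : ℕ) : ℝ) * s ^ (3 + j) * gs + s ^ (3 + j + 1) * gps)
      = X ^ 4 * Qx + s ^ (3 + j + 1) * gs * Γs) :
    A * (B / s) * (s ^ j * (((3 + j + 1 : ℕ) : ℝ) * gs + s * gps)) = (X / s) ^ 4 * Qx + s ^ j * gs * Γs := by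
  have hs' : s ^ 4 ≠ 0 := pow_ne_zero _ hs
  apply mul_left_cancel₀ hs'
  have e1 : s ^ 4 * (A * (B / s) * (s ^ j * (((3 + j + 1 : ℕ) : ℝ) * gs + s * gps)))
      = A * B * (((3 + j + 1 : ℕ) : ℝ) * s ^ (3 + j) * gs + s ^ (3 + j + 1) * gps) := by
    field_simp
    ring
  have e2 : s ^ 4 * ((X / s) ^ 4 * Qx + s ^ j * gs * Γs) = X ^ 4 * Qx + s ^ (3 + j + 1) * gs * Γs := by
    field_simp
    ring
  rw [e1, e2, h]

/-- **Side of the branch relative to a graph barrier with exact order-4 contact** (abstract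
form). [cite: BuckmasterCaolaboraGomezserrano2025, Lemma 3.4, Lemma 4.4, Lemma 4.7] -/
theorem sign_branch_sub_barrier4 {Wc Zc β β' Q : ℝ → ℝ} {r Z0 B1 W1v Z1v k σ : ℝ}
    (hWa : AnalyticAt ℝ Wc 0) (hZa : AnalyticAt ℝ Zc 0)
    (hW0 : Wc 0 = -3 - 2 * Z0) (hZ0 : Zc 0 = Z0)
    (hW1 : deriv Wc 0 = W1v) (hZ1 : deriv Zc 0 = Z1v) (hW1ne : W1v ≠ 0)
    (hode : ∀ᶠ s in 𝓝 (0 : ℝ), DW (Wc s) (Zc s) * deriv Wc s = NW r (Wc s) (Zc s) ∧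
      DZ (Wc s) (Zc s) * deriv Zc s = NZ r (Wc s) (Zc s))
    (hβa : ∀ y, AnalyticAt ℝ β y) (hβd : ∀ y, HasDerivAt β (β' y) y) (hβ'c : Continuous β')
    (hQc : Continuous Q) (hβ0 : β 0 = Z0) (hβ'0 : β' 0 = B1)
    (hfac : ∀ x, Gfun r (-3 - 2 * Z0 + x) (β x) (β' x) = x ^ 4 * Q x)
    (hNZ0 : NZ r (-3 - 2 * Z0) Z0 = 0)
    (hΓ : NZ_Z r (-3 - 2 * Z0) Z0 * DW (-3 - 2 * Z0) Z0 - 2 / 3 * B1 * NW r (-3 - 2 * Z0) Z0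
      = DW (-3 - 2 * Z0) Z0 * ((W1v + 2 * Z1v) / 3) * k)
    (hk3 : 3 < k) (hk4 : k < 4) (hDW0 : 0 < DW (-3 - 2 * Z0) Z0) (hd1 : 0 < (W1v + 2 * Z1v) / 3)
    (hσ : σ = 1 ∨ σ = -1) (hQ : 0 < σ * Q 0) :
    ∀ᶠ s in 𝓝[≠] (0 : ℝ), 0 < σ * (Zc s - β (Wc s - (-3 - 2 * Z0))) := by
  have hσne : σ ≠ 0 := by rcases hσ with h | h <;> simp [h]
  have hQ0ne : Q 0 ≠ 0 := by intro h; rw [h, mul_zero] at hQ; exact lt_irrefl _ hQ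
  -- `x s = Wc s − W₀`, `φ s = Zc s − β (x s)`
  have hx0 : Wc 0 - (-3 - 2 * Z0) = 0 := by rw [hW0]; ring
  have hφ0 : Zc 0 - β (Wc 0 - (-3 - 2 * Z0)) = 0 := by rw [hx0, hβ0, hZ0]; ring
  have hxa : AnalyticAt ℝ (fun s => Wc s - (-3 - 2 * Z0)) 0 := hWa.sub analyticAt_const
  have hφa : AnalyticAt ℝ (fun s => Zc s - β (Wc s - (-3 - 2 * Z0))) 0 :=
    hZa.sub ((hβa _).comp hxa)
  have hWev : ∀ᶠ s in 𝓝 (0 : ℝ), AnalyticAt ℝ Wc s := hWa.eventually_analyticAt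
  have hZev : ∀ᶠ s in 𝓝 (0 : ℝ), AnalyticAt ℝ Zc s := hZa.eventually_analyticAt
  -- the derivative of `φ`
  have hderφ : ∀ᶠ s in 𝓝 (0 : ℝ), HasDerivAt (fun s => Zc s - β (Wc s - (-3 - 2 * Z0)))
      (deriv Zc s - β' (Wc s - (-3 - 2 * Z0)) * deriv Wc s) s := by
    filter_upwards [hWev, hZev] with s hW hZ
    have h1 : HasDerivAt Zc (deriv Zc s) s := hZ.differentiableAt.hasDerivAt
    have h2 : HasDerivAt (fun s => Wc s - (-3 - 2 * Z0)) (deriv Wc s) s :=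
      hW.differentiableAt.hasDerivAt.sub_const _
    exact h1.sub ((hβd _).comp s h2)
  -- the key identity `D_W D_Z φ' = x⁴ Q(x) + φ Γ` near 0
  have hkey : ∀ᶠ s in 𝓝 (0 : ℝ),
      DW (Wc s) (Zc s) * DZ (Wc s) (Zc s) * (deriv Zc s - β' (Wc s - (-3 - 2 * Z0)) * deriv Wc s)
        = (Wc s - (-3 - 2 * Z0)) ^ 4 * Q (Wc s - (-3 - 2 * Z0))
          + (Zc s - β (Wc s - (-3 - 2 * Z0))) * Gam r (Wc s) (β (Wc s - (-3 - 2 * Z0)))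
              (β' (Wc s - (-3 - 2 * Z0))) (Zc s - β (Wc s - (-3 - 2 * Z0))) := by
    filter_upwards [hode] with s hs
    have hG : Gfun r (Wc s) (Zc s) (β' (Wc s - (-3 - 2 * Z0)))
        = (Wc s - (-3 - 2 * Z0)) ^ 4 * Q (Wc s - (-3 - 2 * Z0))
          + (Zc s - β (Wc s - (-3 - 2 * Z0))) * Gam r (Wc s) (β (Wc s - (-3 - 2 * Z0)))
              (β' (Wc s - (-3 - 2 * Z0))) (Zc s - β (Wc s - (-3 - 2 * Z0))) := by
      have h1 : Zc s = β (Wc s - (-3 - 2 * Z0)) + (Zc s - β (Wc s - (-3 - 2 * Z0))) := by ring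
      have h2 := hfac (Wc s - (-3 - 2 * Z0))
      rw [show -3 - 2 * Z0 + (Wc s - (-3 - 2 * Z0)) = Wc s by ring] at h2
      conv_lhs => rw [h1]
      rw [Gfun_add, h2]
    rw [← hG, Gfun_def]
    linear_combination DW (Wc s) (Zc s) * hs.2 - β' (Wc s - (-3 - 2 * Z0)) * DZ (Wc s) (Zc s) * hs.1
  -- `x s ≠ 0` on a punctured neighbourhood, and `x s / s → W₁`
  have hxder : HasDerivAt (fun s => Wc s - (-3 - 2 * Z0)) W1v 0 := by
    have h := (hWa.differentiableAt.hasDerivAt).sub_const (-3 - 2 * Z0)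
    rwa [hW1] at h
  have hTx : Tendsto (fun s => (Wc s - (-3 - 2 * Z0)) / s) (𝓝[≠] (0 : ℝ)) (𝓝 W1v) :=
    tendsto_div_of_hasDerivAt_zero hxder hx0
  have hxne : ∀ᶠ s in 𝓝[≠] (0 : ℝ), Wc s - (-3 - 2 * Z0) ≠ 0 := by
    filter_upwards [hTx.eventually_ne hW1ne] with s hs
    intro h; apply hs; simp [h]
  -- `D_Z / s → d1`, `D_W → DW0`
  have hDZder : HasDerivAt (fun s => DZ (Wc s) (Zc s)) ((W1v + 2 * Z1v) / 3) 0 := by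
    have h1 : HasDerivAt Wc W1v 0 := by rw [← hW1]; exact hWa.differentiableAt.hasDerivAt
    have h2 : HasDerivAt Zc Z1v 0 := by rw [← hZ1]; exact hZa.differentiableAt.hasDerivAt
    have h' : HasDerivAt (fun s => 1 + (Wc s + 2 * Zc s) / 3) ((W1v + 2 * Z1v) / 3) 0 :=
      ((h1.add (h2.const_mul 2)).div_const 3).const_add 1
    refine h'.congr_of_eventuallyEq (Filter.Eventually.of_forall fun s => ?_)
    simp [DZ]
  have hDZ0 : DZ (Wc 0) (Zc 0) = 0 := by rw [hW0, hZ0]; unfold DZ; ring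
  have hTδ : Tendsto (fun s => DZ (Wc s) (Zc s) / s) (𝓝[≠] (0 : ℝ)) (𝓝 ((W1v + 2 * Z1v) / 3)) :=
    tendsto_div_of_hasDerivAt_zero hDZder hDZ0
  have hWc : ContinuousAt Wc 0 := hWa.continuousAt
  have hZc : ContinuousAt Zc 0 := hZa.continuousAt
  have hcDW : Continuous fun p : ℝ × ℝ => DW p.1 p.2 := by unfold DW; fun_prop
  have hTDW : Tendsto (fun s => DW (Wc s) (Zc s)) (𝓝[≠] (0 : ℝ)) (𝓝 (DW (-3 - 2 * Z0) Z0)) := by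
    have hc : ContinuousAt (fun s => DW (Wc s) (Zc s)) 0 :=
      hcDW.continuousAt.comp (hWc.prodMk hZc)
    have h := hc.tendsto
    simp only [hW0, hZ0] at h
    exact tendsto_nhdsWithin_of_tendsto_nhds h
  -- `Γ → Γ₀ = DW0 d1 k`
  have hTΓ : Tendsto (fun s => Gam r (Wc s) (β (Wc s - (-3 - 2 * Z0))) (β' (Wc s - (-3 - 2 * Z0)))
      (Zc s - β (Wc s - (-3 - 2 * Z0)))) (𝓝[≠] (0 : ℝ))
      (𝓝 (DW (-3 - 2 * Z0) Z0 * ((W1v + 2 * Z1v) / 3) * k)) := by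
    have hxc : ContinuousAt (fun s => Wc s - (-3 - 2 * Z0)) 0 := hxa.continuousAt
    have hφc : ContinuousAt (fun s => Zc s - β (Wc s - (-3 - 2 * Z0))) 0 := hφa.continuousAt
    have hβc : Continuous β := continuous_iff_continuousAt.mpr fun y => (hβa y).continuousAt
    have h4 : ContinuousAt (fun s => (Wc s, β (Wc s - (-3 - 2 * Z0)), β' (Wc s - (-3 - 2 * Z0)),
        Zc s - β (Wc s - (-3 - 2 * Z0)))) 0 :=
      hWc.prodMk ((hβc.continuousAt.comp hxc).prodMk ((hβ'c.continuousAt.comp hxc).prodMk hφc))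
    have hc : ContinuousAt (fun s => Gam r (Wc s) (β (Wc s - (-3 - 2 * Z0))) (β' (Wc s - (-3 - 2 * Z0)))
        (Zc s - β (Wc s - (-3 - 2 * Z0)))) 0 := (continuous_Gam r).continuousAt.comp h4
    have h := hc.tendsto
    rw [hφ0, hx0, hW0, hβ0, hβ'0, Gam_zero r Z0 B1 hNZ0, hΓ] at h
    exact tendsto_nhdsWithin_of_tendsto_nhds h
  have hTQ : Tendsto (fun s => Q (Wc s - (-3 - 2 * Z0))) (𝓝[≠] (0 : ℝ)) (𝓝 (Q 0)) := by
    have hc : ContinuousAt (fun s => Q (Wc s - (-3 - 2 * Z0))) 0 := hQc.continuousAt.comp hxa.continuousAt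
    have h := hc.tendsto
    rw [hx0] at h
    exact tendsto_nhdsWithin_of_tendsto_nhds h
  have hTs : Tendsto (fun s : ℝ => s) (𝓝[≠] (0 : ℝ)) (𝓝 0) :=
    tendsto_nhdsWithin_of_tendsto_nhds (continuous_id.tendsto 0)
  -- positivity constants
  have hpos : 0 < DW (-3 - 2 * Z0) Z0 * ((W1v + 2 * Z1v) / 3) := mul_pos hDW0 hd1
  have hW4 : 0 < W1v ^ 4 := by positivity
  -- isolated zeros: either `φ ≡ 0` near 0, or `φ ≠ 0` on a punctured neighbourhood
  rcases hφa.eventually_eq_zero_or_eventually_ne_zero with hzero | hne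
  · -- Case A: `φ ≡ 0` near `0` contradicts `Q 0 ≠ 0`
    exfalso
    rcases eventually_nhds_iff.mp hzero with ⟨U, hUφ, hUo, hU0⟩
    have hφ'0 : ∀ᶠ s in 𝓝 (0 : ℝ), deriv Zc s - β' (Wc s - (-3 - 2 * Z0)) * deriv Wc s = 0 := by
      filter_upwards [hderφ, hUo.mem_nhds hU0] with s hd hsU
      have hloc : (fun s => Zc s - β (Wc s - (-3 - 2 * Z0))) =ᶠ[𝓝 s] fun _ => (0 : ℝ) :=
        Filter.eventually_of_mem (hUo.mem_nhds hsU) fun t ht => hUφ t ht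
      exact hd.unique ((hasDerivAt_const s (0 : ℝ)).congr_of_eventuallyEq hloc)
    have hQz : ∀ᶠ s in 𝓝[≠] (0 : ℝ), Q (Wc s - (-3 - 2 * Z0)) = 0 := by
      have h1 := (hkey.and (hφ'0.and hzero)).filter_mono (nhdsWithin_le_nhds (s := ({0}ᶜ : Set ℝ)))
      filter_upwards [h1, hxne] with s ⟨hk, hd, hz⟩ hx
      rw [hd, hz, mul_zero, zero_mul, add_zero] at hk
      exact (mul_eq_zero.mp hk.symm).resolve_left (pow_ne_zero _ hx)
    exact hQ0ne (eq_of_tendsto_of_eventuallyEq_const hTQ hQz)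
  · -- Case B: `φ = sⁿ g` near `0` with `g` analytic, `g 0 ≠ 0`
    have hnz : ¬∀ᶠ s in 𝓝 (0 : ℝ), Zc s - β (Wc s - (-3 - 2 * Z0)) = 0 := by
      intro hz
      obtain ⟨s, hs1, hs2⟩ := (hne.and (hz.filter_mono (nhdsWithin_le_nhds (s := ({0}ᶜ : Set ℝ))))).exists
      exact hs1 hs2
    obtain ⟨n, g, hga, hg0, hφg⟩ := hφa.exists_eventuallyEq_pow_smul_nonzero_iff.mpr hnz
    simp only [sub_zero, smul_eq_mul] at hφg
    -- `n ≥ 1`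
    have hn1 : 1 ≤ n := by
      rcases Nat.eq_zero_or_pos n with h | h
      · exfalso
        have := hφg.self_of_nhds
        rw [hφ0, h, pow_zero, one_mul] at this
        exact hg0 this.symm
      · exact h
    obtain ⟨m, rfl⟩ : ∃ m, n = m + 1 := ⟨n - 1, by omega⟩
    -- the derivative of `φ = s^(m+1) g`
    have hgev : ∀ᶠ s in 𝓝 (0 : ℝ), AnalyticAt ℝ g s := hga.eventually_analyticAt
    have hφ'eq : ∀ᶠ s in 𝓝 (0 : ℝ), deriv Zc s - β' (Wc s - (-3 - 2 * Z0)) * deriv Wc s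
        = ((m + 1 : ℕ) : ℝ) * s ^ m * g s + s ^ (m + 1) * deriv g s := by
      filter_upwards [hderφ, hgev, hφg.eventually_nhds] with s hd hg hloc
      have h2 : HasDerivAt (fun t => t ^ (m + 1) * g t)
          (((m + 1 : ℕ) : ℝ) * s ^ (m + 1 - 1) * g s + s ^ (m + 1) * deriv g s) s :=
        (hasDerivAt_pow (m + 1) s).mul hg.differentiableAt.hasDerivAt
      rw [Nat.add_sub_cancel] at h2
      exact hd.unique (h2.congr_of_eventuallyEq hloc)
    have hTg : Tendsto g (𝓝[≠] (0 : ℝ)) (𝓝 (g 0)) :=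
      tendsto_nhdsWithin_of_tendsto_nhds hga.continuousAt.tendsto
    have hTg' : Tendsto (fun s => s * deriv g s) (𝓝[≠] (0 : ℝ)) (𝓝 0) := by
      have h2 : Tendsto (fun s => deriv g s) (𝓝[≠] (0 : ℝ)) (𝓝 (deriv g 0)) :=
        tendsto_nhdsWithin_of_tendsto_nhds hga.deriv.continuousAt.tendsto
      simpa using hTs.mul h2
    -- the key identity on the punctured neighbourhood, with `φ = s^(m+1) g` substituted
    have hk2 : ∀ᶠ s in 𝓝[≠] (0 : ℝ), s ≠ 0 ∧
        DW (Wc s) (Zc s) * DZ (Wc s) (Zc s) * (((m + 1 : ℕ) : ℝ) * s ^ m * g s + s ^ (m + 1) * deriv g s)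
          = (Wc s - (-3 - 2 * Z0)) ^ 4 * Q (Wc s - (-3 - 2 * Z0))
            + s ^ (m + 1) * g s * Gam r (Wc s) (β (Wc s - (-3 - 2 * Z0))) (β' (Wc s - (-3 - 2 * Z0)))
                (Zc s - β (Wc s - (-3 - 2 * Z0))) := by
      have h1 := (hkey.and (hφ'eq.and hφg)).filter_mono (nhdsWithin_le_nhds (s := ({0}ᶜ : Set ℝ)))
      filter_upwards [h1, self_mem_nhdsWithin] with s ⟨hk, hd, hφs⟩ hs
      refine ⟨hs, ?_⟩
      rw [hd] at hk
      rw [hk]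
      congr 1
      rw [hφs]
    rcases Nat.lt_or_ge (m + 1) 5 with hle | hgt
    · -- `n ≤ 4`: divide by `s^n`
      obtain ⟨j, hj⟩ : ∃ j, 4 = m + 1 + j := ⟨4 - (m + 1), by omega⟩
      have hid : ∀ᶠ s in 𝓝[≠] (0 : ℝ),
          DW (Wc s) (Zc s) * (DZ (Wc s) (Zc s) / s) * (((m + 1 : ℕ) : ℝ) * g s + s * deriv g s)
            = s ^ j * ((Wc s - (-3 - 2 * Z0)) / s) ^ 4 * Q (Wc s - (-3 - 2 * Z0))
              + g s * Gam r (Wc s) (β (Wc s - (-3 - 2 * Z0))) (β' (Wc s - (-3 - 2 * Z0)))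
                (Zc s - β (Wc s - (-3 - 2 * Z0))) := by
        filter_upwards [hk2] with s ⟨hs, hk⟩
        rw [hj] at hk ⊢
        exact order_identity_le hs hk
      -- limits of both sides
      have hL : Tendsto (fun s => DW (Wc s) (Zc s) * (DZ (Wc s) (Zc s) / s)
          * (((m + 1 : ℕ) : ℝ) * g s + s * deriv g s)) (𝓝[≠] (0 : ℝ))
          (𝓝 (DW (-3 - 2 * Z0) Z0 * ((W1v + 2 * Z1v) / 3) * (((m + 1 : ℕ) : ℝ) * g 0 + 0))) :=
        (hTDW.mul hTδ).mul ((hTg.const_mul _).add hTg')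
      have hR : Tendsto (fun s => s ^ j * ((Wc s - (-3 - 2 * Z0)) / s) ^ 4 * Q (Wc s - (-3 - 2 * Z0))
          + g s * Gam r (Wc s) (β (Wc s - (-3 - 2 * Z0))) (β' (Wc s - (-3 - 2 * Z0)))
            (Zc s - β (Wc s - (-3 - 2 * Z0)))) (𝓝[≠] (0 : ℝ))
          (𝓝 ((0 : ℝ) ^ j * W1v ^ 4 * Q 0 + g 0 * (DW (-3 - 2 * Z0) Z0 * ((W1v + 2 * Z1v) / 3) * k))) :=
        (((hTs.pow j).mul (hTx.pow 4)).mul hTQ).add (hTg.mul hTΓ)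
      have heq := tendsto_nhds_unique hL (hR.congr' (hid.mono fun s h => h.symm))
      rw [add_zero] at heq
      rcases Nat.lt_or_ge (m + 1) 4 with hlt | hge
      · -- `n < 4`: then `n = k < 4`, impossible (`3 < k`)
        exfalso
        rw [zero_pow (by omega), zero_mul, zero_mul, zero_add] at heq
        have h1 : DW (-3 - 2 * Z0) Z0 * ((W1v + 2 * Z1v) / 3) * g 0 * (((m + 1 : ℕ) : ℝ) - k) = 0 := by
          linear_combination heq
        have h2 : (((m + 1 : ℕ) : ℝ) - k) = 0 := by
          rcases mul_eq_zero.mp h1 with h | h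
          · rcases mul_eq_zero.mp h with h' | h'
            · exact absurd h' hpos.ne'
            · exact absurd h' hg0
          · exact h
        have h3 : ((m + 1 : ℕ) : ℝ) = k := by linarith
        have : ((m + 1 : ℕ) : ℝ) ≤ 3 := by exact_mod_cast (by omega : m + 1 ≤ 3)
        linarith
      · -- `n = 4`: the sign of `g 0` is the sign of `Q 0`
        have hj0 : j = 0 := by omega
        subst hj0
        rw [pow_zero, one_mul] at heq
        have h1 : DW (-3 - 2 * Z0) Z0 * ((W1v + 2 * Z1v) / 3) * (((m + 1 : ℕ) : ℝ) - k) * g 0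
            = W1v ^ 4 * Q 0 := by linear_combination heq
        have h4' : ((m + 1 : ℕ) : ℝ) = 4 := by exact_mod_cast (by omega : m + 1 = 4)
        have h4k : 0 < ((m + 1 : ℕ) : ℝ) - k := by rw [h4']; linarith
        have hc : 0 < DW (-3 - 2 * Z0) Z0 * ((W1v + 2 * Z1v) / 3) * (((m + 1 : ℕ) : ℝ) - k) :=
          mul_pos hpos h4k
        have hσg : 0 < σ * g 0 := by
          have h2 : DW (-3 - 2 * Z0) Z0 * ((W1v + 2 * Z1v) / 3) * (((m + 1 : ℕ) : ℝ) - k) * (σ * g 0)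
              = W1v ^ 4 * (σ * Q 0) := by linear_combination σ * h1
          have h3 : 0 < DW (-3 - 2 * Z0) Z0 * ((W1v + 2 * Z1v) / 3) * (((m + 1 : ℕ) : ℝ) - k)
              * (σ * g 0) := by rw [h2]; exact mul_pos hW4 hQ
          exact pos_of_mul_pos_right h3 hc.le
        -- conclude on a punctured neighbourhood
        have hgpos : ∀ᶠ s in 𝓝 (0 : ℝ), 0 < σ * g s :=
          (hga.continuousAt.tendsto.const_mul σ).eventually (lt_mem_nhds hσg)
        have h1' := (hφg.and hgpos).filter_mono (nhdsWithin_le_nhds (s := ({0}ᶜ : Set ℝ)))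
        filter_upwards [h1', self_mem_nhdsWithin] with s ⟨hφs, hgs⟩ hs
        rw [hφs]
        have hm8 : m + 1 = 2 * 2 := by omega
        have hs8 : 0 < s ^ (m + 1) := by rw [hm8]; exact Even.pow_pos (by decide) hs
        have := mul_pos hs8 hgs
        linarith [show σ * (s ^ (m + 1) * g s) = s ^ (m + 1) * (σ * g s) by ring]
    · -- `n ≥ 5`: divide by `s^4`, the limit gives `Q 0 = 0`
      exfalso
      obtain ⟨j, hj⟩ : ∃ j, m = 3 + j := ⟨m - 3, by omega⟩
      subst hj
      have hid : ∀ᶠ s in 𝓝[≠] (0 : ℝ),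
          DW (Wc s) (Zc s) * (DZ (Wc s) (Zc s) / s) * (s ^ j * (((3 + j + 1 : ℕ) : ℝ) * g s + s * deriv g s))
            = ((Wc s - (-3 - 2 * Z0)) / s) ^ 4 * Q (Wc s - (-3 - 2 * Z0))
              + s ^ j * g s * Gam r (Wc s) (β (Wc s - (-3 - 2 * Z0))) (β' (Wc s - (-3 - 2 * Z0)))
                (Zc s - β (Wc s - (-3 - 2 * Z0))) := by
        filter_upwards [hk2] with s ⟨hs, hk⟩
        exact order_identity_ge4 hs hk
      have hL : Tendsto (fun s => DW (Wc s) (Zc s) * (DZ (Wc s) (Zc s) / s)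
          * (s ^ j * (((3 + j + 1 : ℕ) : ℝ) * g s + s * deriv g s))) (𝓝[≠] (0 : ℝ))
          (𝓝 (DW (-3 - 2 * Z0) Z0 * ((W1v + 2 * Z1v) / 3)
            * ((0 : ℝ) ^ j * (((3 + j + 1 : ℕ) : ℝ) * g 0 + 0)))) :=
        (hTDW.mul hTδ).mul ((hTs.pow j).mul ((hTg.const_mul _).add hTg'))
      have hR : Tendsto (fun s => ((Wc s - (-3 - 2 * Z0)) / s) ^ 4 * Q (Wc s - (-3 - 2 * Z0))
          + s ^ j * g s * Gam r (Wc s) (β (Wc s - (-3 - 2 * Z0))) (β' (Wc s - (-3 - 2 * Z0)))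
            (Zc s - β (Wc s - (-3 - 2 * Z0)))) (𝓝[≠] (0 : ℝ))
          (𝓝 (W1v ^ 4 * Q 0 + (0 : ℝ) ^ j * g 0 * (DW (-3 - 2 * Z0) Z0 * ((W1v + 2 * Z1v) / 3) * k))) :=
        ((hTx.pow 4).mul hTQ).add (((hTs.pow j).mul hTg).mul hTΓ)
      have heq := tendsto_nhds_unique hL (hR.congr' (hid.mono fun s h => h.symm))
      have hj1 : j ≠ 0 := by omega
      rw [zero_pow hj1] at heq
      simp only [zero_mul, mul_zero, add_zero] at heq
      rcases mul_eq_zero.mp heq.symm with h' | h'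
      · exact absurd h' hW4.ne'
      · exact hQ0ne h'

/-- **Side of the analytic branch relative to the near-piece barrier**, for the branch
`(W^{(r)}, Z^{(r)}) = (Wloc r, Zloc r)` of the tree, `r ∈ (r₃, r₄)`, `B₁ = Z₁/W₁`: if
`σ Q̃(0) > 0` then `σ (Z^{(r)}(s) − β(W^{(r)}(s) − W₀)) > 0` for all small `s ≠ 0` (both signs of
`s`: to the right of `P_s` for `s < 0`, to the left for `s > 0`). The non-degeneracy conditions
`cB_j ≠ 0` (`j = 2, 3`) are numerical and supplied by the caller.
[cite: BuckmasterCaolaboraGomezserrano2025, Lemma 3.4, Lemma 4.4, Lemma 4.7] -/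
theorem sign_branch_sub_beta4Near {r b4 σ : ℝ} (h3 : r3 < r) (h4 : r < r4)
    (h2 : cB2 r (Z0 r) (Z1 r / W1 r) ≠ 0) (h3' : cB3 r (Z0 r) (Z1 r / W1 r) ≠ 0)
    (hσ : σ = 1 ∨ σ = -1) (hQ : 0 < σ * Qt4Near r (Z0 r) (Z1 r / W1 r) b4 0) :
    ∀ᶠ s in 𝓝[≠] (0 : ℝ),
      0 < σ * (SonicSeries.Zloc r s - beta4Near r (Z0 r) (Z1 r / W1 r) b4 (SonicSeries.Wloc r s - W0 r)) := by
  have hm := r3_r4_mem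
  have h1 : 1 < r := hm.1.trans h3
  have hr : r < rstar := h4.trans hm.2.2
  have hr2 : r < 2 := by linarith [rstar_lt]
  have hd := (disc_pos hr).le
  have hq : q r ≠ 0 := (q_pos hr).ne'
  obtain ⟨hW0, hZ0, hW1, hZ1, hspec⟩ := SonicSeries.sonicSeries_spec' h3 h4
  have hρ : 0 < SonicSeries.sonicRad r := SonicSeries.sonicRad_pos hr
  have h0ρ : |(0 : ℝ)| < SonicSeries.sonicRad r := by rw [abs_zero]; exact hρ
  have hWa : AnalyticAt ℝ (SonicSeries.Wloc r) 0 := (hspec 0 h0ρ).1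
  have hZa : AnalyticAt ℝ (SonicSeries.Zloc r) 0 := (hspec 0 h0ρ).2.1
  have hode : ∀ᶠ s in 𝓝 (0 : ℝ),
      DW (SonicSeries.Wloc r s) (SonicSeries.Zloc r s) * deriv (SonicSeries.Wloc r) s
          = NW r (SonicSeries.Wloc r s) (SonicSeries.Zloc r s) ∧
        DZ (SonicSeries.Wloc r s) (SonicSeries.Zloc r s) * deriv (SonicSeries.Zloc r) s
          = NZ r (SonicSeries.Wloc r s) (SonicSeries.Zloc r s) := by
    have hmem : {s : ℝ | |s| < SonicSeries.sonicRad r} ∈ 𝓝 (0 : ℝ) := by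
      have : {s : ℝ | |s| < SonicSeries.sonicRad r} = Metric.ball 0 (SonicSeries.sonicRad r) := by
        ext s; simp [Metric.mem_ball]
      rw [this]; exact Metric.ball_mem_nhds _ hρ
    filter_upwards [hmem] with s hs
    exact ⟨(hspec s hs).2.2.1, (hspec s hs).2.2.2⟩
  have hW1ne : W1 r ≠ 0 := by unfold W1; exact mul_ne_zero (by norm_num) hq
  have hB1 : W1 r * (Z1 r / W1 r) = Z1 r := by field_simp
  have hq0 : q0 r (Z0 r) = 0 := q0_Ps hd
  have hq1 : q1 r (Z0 r) (Z1 r / W1 r) = 0 := q1_Ps h1.le hd hq hB1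
  have hfac : ∀ x, Gfun r (-3 - 2 * Z0 r + x) (beta4Near r (Z0 r) (Z1 r / W1 r) b4 x)
      (dbeta4Near r (Z0 r) (Z1 r / W1 r) b4 x) = x ^ 4 * Qt4Near r (Z0 r) (Z1 r / W1 r) b4 x :=
    fun x => Gfun_beta4Near_eq r (Z0 r) (Z1 r / W1 r) b4 x hq0 hq1 h2 h3'
  have hNZ0 : NZ r (-3 - 2 * Z0 r) (Z0 r) = 0 := by rw [← W0_eq_Z0]; exact NZ_Ps hd
  have hDW0 : 0 < DW (-3 - 2 * Z0 r) (Z0 r) := by rw [← W0_eq_Z0]; exact DW_Ps_pos hr2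
  have hd1 : 0 < (W1 r + 2 * Z1 r) / 3 := by
    have := DZ1_pos hr
    have e : (W1 r + 2 * Z1 r) / 3 = 1 / 3 * W1 r + 2 / 3 * Z1 r := by ring
    rw [e, DZ1_eq]; exact this
  have hk := k_mem_Ioo h3 h4
  have h := sign_branch_sub_barrier4 (β := beta4Near r (Z0 r) (Z1 r / W1 r) b4)
    (β' := dbeta4Near r (Z0 r) (Z1 r / W1 r) b4) (Q := Qt4Near r (Z0 r) (Z1 r / W1 r) b4)
    hWa hZa (by rw [hW0, W0_eq_Z0]) hZ0 hW1 hZ1 hW1ne hode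
    (fun y => analyticAt_beta4Near _ _ _ _ y) (fun y => hasDerivAt_beta4Near _ _ _ _ y)
    (continuous_dbeta4Near _ _ _ _) (continuous_Qt4Near _ _ _ _)
    (beta4Near_zero _ _ _ _) (dbeta4Near_zero _ _ _ _) hfac hNZ0 (Gam_Ps_eq hr) hk.1 hk.2 hDW0 hd1 hσ hQ
  simpa only [W0_eq_Z0] using h

end Monatomic

end BuckmasterCaolaboraGomezserrano2025

end Literature.Analysis.FluidPDE
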